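/-
Copyright: harness cell b2b-lgcu-borel (gen 19).  Honest framing: the VALUE here is a THEOREM
(structural laws on every hypothetical witness of the crux) — NOT summit progress; the crux item
`SubgroupIdentityDesigns` (stmt-MatrixMultiplication-14079) stays open and untouched.
-/
import Mathlib
import Summits.MatrixMultiplication.MatrixMultiplication.Theorems.SubgroupIdentityDesigns.Negative.LevelOneExact
import Summits.MatrixMultiplication.MatrixMultiplication.Theorems.SubgroupIdentityDesigns.Negative.LevelOneDim
import Summits.MatrixMultiplication.MatrixMultiplication.Theorems.SubgroupIdentityDesigns.Negative.LevelOneFloor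

/-!
# Level one in every dimension: the number `b`, the dimension bound and the `ℓ^s` volume floor

Route `LevelGradedCohnUmans`, crux `SubgroupIdentityDesigns`, negative side; level `k = 1`,
dimension `m = 1 + l` (`l ≥ 1`), every prime `p`.  With `b = (p^{1+l} − 1)/(p − 1)` (exact
division; `sub_one_mul_b`, `b_cast`; `b ≥ p + 1`, and `b ≥ p² + p + 1` when `l ≥ 2`):

* `finrank_le_formula` : **`dim F_1|_{GL_{1+l}(𝔽_p)} ≤ (p − 1) b² − 2 b + 2`**
  (`LevelOneDim.finrank_levelOne_le_real` rewritten over `b`; `_nat` : the same in `ℕ`);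
* `volume_gt_floor` : THE MASTER FLOOR IN EVERY DIMENSION — a subgroup triple of `GL_{1+l}(𝔽_p)`
  satisfying the crux inequality `budget p (1+l) 1 (2+ε) < V^{(2+ε)/3}` at `−2 < ε ≤ 1` has
  **`V > 1 + (b − 1)³ + (p − 2) b³ = (p − 1) b³ − 3 b² + 3 b`** (no TPP, no design needed): the
  `ℓ^s`-monotonicity (`rpow_le_of_le_three`, `0 < s ≤ 3`, built on `LevelOneFloor`'s
  `rpow_le_rpow_sub_one_mul`) of the exact level-one degree sum
  `1 + (b−1)^s + (p−2) b^s ≤ budget` of `LevelOneExact.budget_ge_exact`, exactly as the `m = 2`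
  file `LevelOneFloor` does with `b = p + 1` (`_nat` : the same in `ℕ`).

Used by `Negative/LevelOneWindowAll.lean` and `Negative/LevelOneSmallPrimes.lean`.  Honest framing:
VALUE = THEOREM, NOT summit progress.  Sorry-free; standard axioms; no new definitions.  Report:
`run/shared/lean/b2b/levelgraded-cu/ORACLE-g19.md` §G19-2.
-/

set_option linter.dupNamespace false

noncomputable section

open scoped BigOperators Classical Matrix
open Module (finrank)

namespace Summit.MatrixMultiplication.MatrixMultiplication.Theorems.SubgroupIdentityDesigns.Negative
namespace LevelOneFloorAll

open Summit.MatrixMultiplication.MatrixMultiplication.Theorems.LieRankDesigns.Negative (GLm budget)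
open Summit.MatrixMultiplication.MatrixMultiplication.Theorems.LevelOneGL2Designs.Negative
  (levelSubmodule)
open LevelOneExact (budget_ge_exact)
open LevelOneDim (finrank_levelOne_le_real)

section LevelOne

variable {p : ℕ} [hp : Fact p.Prime] {l : ℕ}

omit hp in
/-- `p − 1 ∣ p^{1+l} − 1`. -/
theorem sub_one_dvd : p - 1 ∣ p ^ (1 + l) - 1 :=
  Nat.sub_one_dvd_pow_sub_one _ _

omit hp in
/-- `(p − 1) · b = p^{1+l} − 1` for `b = (p^{1+l} − 1)/(p − 1)` (exact division). -/
theorem sub_one_mul_b : (p - 1) * ((p ^ (1 + l) - 1) / (p - 1)) = p ^ (1 + l) - 1 :=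
  Nat.mul_div_cancel' sub_one_dvd

/-- `b ≥ p + 1` when `l ≥ 1`. -/
theorem succ_le_b (hl : 1 ≤ l) : p + 1 ≤ (p ^ (1 + l) - 1) / (p - 1) := by
  have hp2 : 2 ≤ p := hp.out.two_le
  rw [Nat.le_div_iff_mul_le (by omega)]
  have hP : p ^ 2 ≤ p ^ (1 + l) := Nat.pow_le_pow_right (by omega) (by omega)
  have h1 : 1 ≤ p ^ (1 + l) := Nat.one_le_pow _ _ (by omega)
  zify [h1, (show 1 ≤ p by omega)] at hP ⊢
  nlinarith [hP]

/-- `b ≥ p² + p + 1` when `l ≥ 2`. -/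
theorem sq_succ_le_b (hl : 2 ≤ l) : p ^ 2 + p + 1 ≤ (p ^ (1 + l) - 1) / (p - 1) := by
  have hp2 : 2 ≤ p := hp.out.two_le
  rw [Nat.le_div_iff_mul_le (by omega)]
  have hP : p ^ 3 ≤ p ^ (1 + l) := Nat.pow_le_pow_right (by omega) (by omega)
  have h1 : 1 ≤ p ^ (1 + l) := Nat.one_le_pow _ _ (by omega)
  zify [h1, (show 1 ≤ p by omega)] at hP ⊢
  nlinarith [hP]

/-- The real number `b`: `((p^{1+l} − 1)/(p − 1) : ℕ)` cast to `ℝ` IS `(p^{1+l} − 1)/(p − 1)`. -/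
theorem b_cast :
    (((p ^ (1 + l) - 1) / (p - 1) : ℕ) : ℝ) = ((p : ℝ) ^ (1 + l) - 1) / ((p : ℝ) - 1) := by
  have hp2 : 2 ≤ p := hp.out.two_le
  have hpR : (2 : ℝ) ≤ p := by exact_mod_cast hp2
  have h1 : 1 ≤ p ^ (1 + l) := Nat.one_le_pow _ _ (by omega)
  have hb := sub_one_mul_b (p := p) (l := l)
  have hbR : ((p : ℝ) - 1) * (((p ^ (1 + l) - 1) / (p - 1) : ℕ) : ℝ) = (p : ℝ) ^ (1 + l) - 1 := by
    have h : (((p - 1) * ((p ^ (1 + l) - 1) / (p - 1)) : ℕ) : ℝ) = ((p ^ (1 + l) - 1 : ℕ) : ℝ) := by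
      exact_mod_cast hb
    push_cast [Nat.cast_sub (show 1 ≤ p by omega), Nat.cast_sub h1] at h
    exact h
  rw [eq_div_iff (by linarith : ((p : ℝ) - 1) ≠ 0), mul_comm]
  exact hbR

/-- `a = b − 1` over `ℝ`: `(p^{1+l} − p)/(p − 1) = b − 1`. -/
theorem a_cast : ((p : ℝ) ^ (1 + l) - p) / ((p : ℝ) - 1) =
    (((p ^ (1 + l) - 1) / (p - 1) : ℕ) : ℝ) - 1 := by
  have hpR : (2 : ℝ) ≤ p := by exact_mod_cast hp.out.two_le
  rw [b_cast, eq_sub_iff_add_eq, div_add_one (by linarith : ((p : ℝ) - 1) ≠ 0)]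
  congr 1
  ring

/-- **THE DIMENSION OVER `b`**: `dim F_1|_{GL_{1+l}(𝔽_p)} ≤ (p − 1) b² − 2 b + 2` (`l ≥ 0`). -/
theorem finrank_le_formula :
    (finrank ℂ (levelSubmodule p (1 + l) 1) : ℝ) ≤
      ((p : ℝ) - 1) * (((p ^ (1 + l) - 1) / (p - 1) : ℕ) : ℝ) ^ 2 -
        2 * (((p ^ (1 + l) - 1) / (p - 1) : ℕ) : ℝ) + 2 := by
  have h := finrank_levelOne_le_real (p := p) (m := 1 + l) (by omega)
  rw [a_cast, b_cast.symm] at h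
  have e : 1 + ((((p ^ (1 + l) - 1) / (p - 1) : ℕ) : ℝ) - 1) ^ 2 +
      ((p : ℝ) - 2) * (((p ^ (1 + l) - 1) / (p - 1) : ℕ) : ℝ) ^ 2 =
      ((p : ℝ) - 1) * (((p ^ (1 + l) - 1) / (p - 1) : ℕ) : ℝ) ^ 2 -
        2 * (((p ^ (1 + l) - 1) / (p - 1) : ℕ) : ℝ) + 2 := by ring
  rw [e] at h
  exact h

/-- The same in `ℕ`: `dim F_1|_G + 2b ≤ (p − 1) b² + 2`. -/
theorem finrank_le_formula_nat :
    finrank ℂ (levelSubmodule p (1 + l) 1) + 2 * ((p ^ (1 + l) - 1) / (p - 1)) ≤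
      (p - 1) * ((p ^ (1 + l) - 1) / (p - 1)) ^ 2 + 2 := by
  have h := finrank_le_formula (p := p) (l := l)
  have hp1 : 1 ≤ p := hp.out.one_lt.le
  have h' : ((finrank ℂ (levelSubmodule p (1 + l) 1) + 2 * ((p ^ (1 + l) - 1) / (p - 1)) : ℕ) : ℝ)
      ≤ (((p - 1) * ((p ^ (1 + l) - 1) / (p - 1)) ^ 2 + 2 : ℕ) : ℝ) := by
    push_cast [Nat.cast_sub hp1]
    linarith
  exact_mod_cast h'

omit hp in
/-- **`ℓ^s`-MONOTONICITY OF A THREE-TERM DEGREE SUM.**  For `x, y ≥ 0`, a weight `w = 0` or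
`w ≥ 1`, `0 < s ≤ 3` and `0 ≤ V ≤ 1 + x³ + w y³`:  `V^{s/3} ≤ 1 + x^s + w y^s`. -/
theorem rpow_le_of_le_three {x y w V s : ℝ} (hx : 0 ≤ x) (hy : 0 ≤ y) (hw : w = 0 ∨ 1 ≤ w)
    (hV0 : 0 ≤ V) (hV : V ≤ 1 + x ^ (3 : ℝ) + w * y ^ (3 : ℝ)) (hs0 : 0 < s) (hs3 : s ≤ 3) :
    V ^ (s / 3) ≤ 1 + x ^ s + w * y ^ s := by
  set A : ℝ := 1 + x ^ s + w * y ^ s with hA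
  have hxs : 0 ≤ x ^ s := Real.rpow_nonneg hx s
  have hys : 0 ≤ y ^ s := Real.rpow_nonneg hy s
  have hw0 : 0 ≤ w := by rcases hw with h | h <;> linarith
  have hwys : 0 ≤ w * y ^ s := mul_nonneg hw0 hys
  have h1A : (1 : ℝ) ≤ A := by rw [hA]; linarith
  have h2A : x ^ s ≤ A := by rw [hA]; linarith
  have hA0 : 0 ≤ A := by linarith
  set r : ℝ := 3 / s with hr
  have hr1 : 1 ≤ r := by
    rw [hr, le_div_iff₀ hs0]
    linarith
  have hsr : s * r = 3 := by rw [hr, mul_div_cancel₀ (3 : ℝ) hs0.ne']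
  have e1 : (1 : ℝ) = (1 : ℝ) ^ r := (Real.one_rpow r).symm
  have e2 : x ^ (3 : ℝ) = (x ^ s) ^ r := by rw [← Real.rpow_mul hx, hsr]
  have e3 : y ^ (3 : ℝ) = (y ^ s) ^ r := by rw [← Real.rpow_mul hy, hsr]
  have t1 : (1 : ℝ) ^ r ≤ A ^ (r - 1) * 1 := rpow_le_rpow_sub_one_mul zero_le_one h1A hr1
  have t2 : (x ^ s) ^ r ≤ A ^ (r - 1) * x ^ s := rpow_le_rpow_sub_one_mul hxs h2A hr1
  have t3 : w * (y ^ s) ^ r ≤ w * (A ^ (r - 1) * y ^ s) := by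
    rcases hw with h | h
    · rw [h, zero_mul, zero_mul]
    · have h3A : y ^ s ≤ A := by
        have hm : 1 * y ^ s ≤ w * y ^ s := mul_le_mul_of_nonneg_right h hys
        rw [one_mul] at hm
        rw [hA]
        linarith
      exact mul_le_mul_of_nonneg_left (rpow_le_rpow_sub_one_mul hys h3A hr1) hw0
  have key : 1 + x ^ (3 : ℝ) + w * y ^ (3 : ℝ) ≤ A ^ r := by
    have eA : A ^ (r - 1) * A = A ^ r := by
      have h := Real.rpow_add' hA0 (show (r - 1) + 1 ≠ 0 by linarith)
      rw [sub_add_cancel, Real.rpow_one] at h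
      exact h.symm
    calc 1 + x ^ (3 : ℝ) + w * y ^ (3 : ℝ)
        = (1 : ℝ) ^ r + (x ^ s) ^ r + w * (y ^ s) ^ r := by rw [← e1, ← e2, ← e3]
      _ ≤ A ^ (r - 1) * 1 + A ^ (r - 1) * x ^ s + w * (A ^ (r - 1) * y ^ s) := by linarith
      _ = A ^ (r - 1) * A := by rw [hA]; ring
      _ = A ^ r := eA
  have hrs : r * (s / 3) = 1 := by
    rw [hr]
    field_simp
  calc V ^ (s / 3) ≤ (A ^ r) ^ (s / 3) := Real.rpow_le_rpow hV0 (hV.trans key) (by linarith)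
    _ = A := by rw [← Real.rpow_mul hA0, hrs, Real.rpow_one]

/-- **THE LEVEL-ONE FLOOR IN EVERY DIMENSION** (`l ≥ 1`, any prime `p`, `−2 < ε ≤ 1`): a subgroup
triple of `GL_{1+l}(𝔽_p)` satisfying the crux inequality `budget p (1+l) 1 (2+ε) < V^{(2+ε)/3}` has
`V > 1 + (b − 1)³ + (p − 2) b³ = (p − 1) b³ − 3 b² + 3 b` — no TPP and no design needed. -/
theorem volume_gt_floor (hl : 1 ≤ l) {ε : ℝ} (hε : -2 < ε) (hε1 : ε ≤ 1)
    {H₁ H₂ H₃ : Subgroup (GLm p (1 + l))}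
    (hlt : budget p (1 + l) 1 (2 + ε) <
      ((Nat.card H₁ * Nat.card H₂ * Nat.card H₃ : ℕ) : ℝ) ^ ((2 + ε) / 3)) :
    ((p : ℝ) - 1) * (((p ^ (1 + l) - 1) / (p - 1) : ℕ) : ℝ) ^ 3 -
        3 * (((p ^ (1 + l) - 1) / (p - 1) : ℕ) : ℝ) ^ 2 +
        3 * (((p ^ (1 + l) - 1) / (p - 1) : ℕ) : ℝ) <
      ((Nat.card H₁ * Nat.card H₂ * Nat.card H₃ : ℕ) : ℝ) := by
  have hp2 : 2 ≤ p := hp.out.two_le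
  have hpR : (2 : ℝ) ≤ p := by exact_mod_cast hp2
  set bR : ℝ := (((p ^ (1 + l) - 1) / (p - 1) : ℕ) : ℝ) with hbR_def
  have hb1 : (p : ℝ) + 1 ≤ bR := by
    rw [hbR_def]
    exact_mod_cast succ_le_b (p := p) hl
  have hx : (0 : ℝ) ≤ bR - 1 := by linarith
  have hy : (0 : ℝ) ≤ bR := by linarith
  have hw : (p : ℝ) - 2 = 0 ∨ 1 ≤ (p : ℝ) - 2 := by
    rcases Nat.lt_or_ge p 3 with h | h
    · left
      have : p = 2 := by omega
      subst this
      norm_num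
    · right
      have : (3 : ℝ) ≤ p := by exact_mod_cast h
      linarith
  by_contra hcon
  push Not at hcon
  set V : ℝ := ((Nat.card H₁ * Nat.card H₂ * Nat.card H₃ : ℕ) : ℝ) with hV_def
  have hV0 : 0 ≤ V := Nat.cast_nonneg _
  have hVle : V ≤ 1 + (bR - 1) ^ (3 : ℝ) + ((p : ℝ) - 2) * bR ^ (3 : ℝ) := by
    have e1 : (bR - 1) ^ (3 : ℝ) = (bR - 1) ^ (3 : ℕ) := by
      rw [show (3 : ℝ) = ((3 : ℕ) : ℝ) by norm_num, Real.rpow_natCast]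
    have e2 : bR ^ (3 : ℝ) = bR ^ (3 : ℕ) := by
      rw [show (3 : ℝ) = ((3 : ℕ) : ℝ) by norm_num, Real.rpow_natCast]
    rw [e1, e2]
    nlinarith [hcon]
  have hmono := rpow_le_of_le_three hx hy hw hV0 hVle (s := 2 + ε) (by linarith) (by linarith)
  have hfloor := budget_ge_exact (p := p) hl (2 + ε)
  rw [a_cast, b_cast.symm] at hfloor
  exact absurd (hmono.trans hfloor) (not_le.2 hlt)

/-- The floor in `ℕ`: `(p − 1) b³ + 3 b + 1 ≤ V + 3 b²`. -/
theorem volume_gt_floor_nat (hl : 1 ≤ l) {ε : ℝ} (hε : -2 < ε) (hε1 : ε ≤ 1)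
    {H₁ H₂ H₃ : Subgroup (GLm p (1 + l))}
    (hlt : budget p (1 + l) 1 (2 + ε) <
      ((Nat.card H₁ * Nat.card H₂ * Nat.card H₃ : ℕ) : ℝ) ^ ((2 + ε) / 3)) :
    (p - 1) * ((p ^ (1 + l) - 1) / (p - 1)) ^ 3 + 3 * ((p ^ (1 + l) - 1) / (p - 1)) + 1 ≤
      Nat.card H₁ * Nat.card H₂ * Nat.card H₃ + 3 * ((p ^ (1 + l) - 1) / (p - 1)) ^ 2 := by
  have h := volume_gt_floor (p := p) hl hε hε1 hlt
  have hp1 : 1 ≤ p := hp.out.one_lt.le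
  push_cast at h
  have h' : (((p - 1) * ((p ^ (1 + l) - 1) / (p - 1)) ^ 3 + 3 * ((p ^ (1 + l) - 1) / (p - 1)) : ℕ)
      : ℝ) < ((Nat.card H₁ * Nat.card H₂ * Nat.card H₃ + 3 * ((p ^ (1 + l) - 1) / (p - 1)) ^ 2 :
        ℕ) : ℝ) := by
    push_cast [Nat.cast_sub hp1]
    linarith
  have h'' := Nat.cast_lt.1 h'
  omega

end LevelOne

end LevelOneFloorAll

end Summit.MatrixMultiplication.MatrixMultiplication.Theorems.SubgroupIdentityDesigns.Negative
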